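import Literature.Probability.LatticeModels.ExplorationWinding
import HarnessLib

/-!
# The turning rule as a permutation of corners; toggling an edge; the interface cycle

Topic `Literature/Probability/LatticeModels`; fourth instalment of the discharge programme for
crit-ising.S18, node 1 (s-holomorphicity of the FK-Ising observable, Smirnov 2010 Lemma 4.5),
whose proof rests on "the rearrangement of connections at the point `v`" under the involution
`ω ↦ ω △ {e}`. On the coded corners `(v, k) : Site 2 × Fin 4` of `MedialInterfaceProofs.lean`
(successor map `nextCorner β`, orbits `cornerOrbit β c`), everything here is proved:

* `prevCorner`, `cornerPerm`: the turning rule is a **permutation** of all corners of `ℤ²`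
  (explicit inverse: a corner was reached by following its source edge if that edge is open, by
  crossing it otherwise);
* `cornerPartner`, `cTgt_eq_cTgt_iff`: exactly two corners arrive at each edge, `p` and its
  partner `(v + u_{k+1}, k + 2)` at the other endpoint in the opposite face; `nextCorner_toggle`:
  **toggling the edge `e = cTgt p` composes the turning rule with the transposition of `p` and
  its partner** (they exchange successors, every other corner keeps its successor) — so the
  cycles of the permutation through `p` and its partner merge or split, all others are unchanged;
* orbits of a completed configuration `D.bcBondConfig ω` keep their vertex in `Ω_δ`
  (`cornerOrbit_fst_mem_meshDomain`) and are therefore **periodic** for admissible (bounded)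
  data (`exists_cornerOrbit_period`); periodic orbits are closed under predecessors
  (`exists_eq_cornerOrbit_of_iterate`);
* the **interface cycle**: on the orbit of the start corner, a step from a non-inner face into
  an inner face is the step into the start corner (`cornerOrbit_entry`, dual to
  `cornerOrbit_exit`: the crossed edge is an `A`–`B` edge sourced at its `A`-end, unique by
  `existsUnique_startCorner`); hence between the exit time `N` and the period `P` all faces are
  non-inner, `N < P` (`exit_lt_period`), and **the corners of the interface cycle with inner face
  are exactly the darts of the exploration path** (`isInnerFace_cornerOrbit_iff`:
  inner `↔ s % P < N`).

These are the inputs of the case analysis of the interface under `ω ↦ ω △ {e}` (no corner of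
`e` on the path: unchanged; both: a stretch is excised into a separate loop; one: the loop
through the partner is spliced in), carried out in the next instalment.

Sources: Smirnov, C. R. Acad. Sci. Paris 333 (2001), §2 (the exploration process); Smirnov,
Ann. Math. 172 (2010), proof of Lemma 4.5 (the involution and the local rearrangement, Fig. 5);
Grimmett, *Percolation* (1999), §11.2 (medial lattice conventions).
-/

noncomputable section

namespace Literature.Probability.LatticeModels

open SimpleGraph

variable {β : Percolation.BondConfig (Site 2)}

/-! ### The predecessor corner: `nextCorner β` is a permutation of the coded corners -/

open scoped Classical in
/-- The predecessor of the coded corner `q` under the turning rule: if the source edge of `q` is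
open, `q` was reached by following it from its other endpoint inside the same face; if it is
closed, by crossing it around the same vertex from the previous face clockwise. [cite: Smirnov2001, §2] -/
def prevCorner (β : Percolation.BondConfig (Site 2)) (q : Site 2 × Fin 4) : Site 2 × Fin 4 :=
  if cSrc q ∈ β then (q.1 + cornerUnit q.2, q.2 + 1) else (q.1, q.2 + 3)

/-- `Fin 4` arithmetic. [folklore] -/
theorem fin4_add_three_add_one (k : Fin 4) : k + 3 + 1 = k := by revert k; decide

/-- `Fin 4` arithmetic. [folklore] -/
theorem fin4_add_one_add_one (k : Fin 4) : k + 1 + 1 = k + 2 := by revert k; decide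

/-- `Fin 4` arithmetic. [folklore] -/
theorem fin4_add_one_add_two (k : Fin 4) : k + 1 + 2 = k + 3 := by revert k; decide

/-- `Fin 4` arithmetic. [folklore] -/
theorem fin4_add_three_add_three (k : Fin 4) : k + 3 + 3 = k + 2 := by revert k; decide

/-- `Fin 4` arithmetic. [folklore] -/
theorem fin4_add_two_add_one (k : Fin 4) : k + 2 + 1 = k + 3 := by revert k; decide

/-- `Fin 4` arithmetic. [folklore] -/
theorem fin4_add_two_add_two' (k : Fin 4) : k + 2 + 2 = k := by revert k; decide

/-- `Fin 4` arithmetic. [folklore] -/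
theorem fin4_eq_add_two_of {j k : Fin 4} (h : j + 1 = k + 3) : j = k + 2 := by
  revert j k; decide

/-- `Fin 4` arithmetic. [folklore] -/
theorem fin4_add_two_add_three (k : Fin 4) : k + 2 + 3 = k + 1 := by revert k; decide

/-- The target edge of the follow-predecessor `(v + u_k, k + 1)` of `(v, k)` is the source edge of
`(v, k)`. [cite: Smirnov2001, §2] -/
theorem cTgt_followPred (q : Site 2 × Fin 4) : cTgt (q.1 + cornerUnit q.2, q.2 + 1) = cSrc q := by
  rw [cTgt, cSrc]
  simp only
  rw [fin4_add_one_add_one, cornerUnit_add_two, ← sub_eq_add_neg, add_sub_cancel_right, Sym2.eq_swap]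

/-- The target edge of the cross-predecessor `(v, k + 3)` of `(v, k)` is the source edge of
`(v, k)`. [cite: Smirnov2001, §2] -/
theorem cTgt_crossPred (q : Site 2 × Fin 4) : cTgt (q.1, q.2 + 3) = cSrc q := by
  rw [cTgt, cSrc]
  simp only
  rw [fin4_add_three_add_one]

/-- `prevCorner` is a right inverse of `nextCorner`. [cite: Smirnov2001, §2] -/
theorem nextCorner_prevCorner (q : Site 2 × Fin 4) : nextCorner β (prevCorner β q) = q := by
  classical
  unfold prevCorner
  split_ifs with h
  · rw [nextCorner_of_mem (by rwa [cTgt_followPred])]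
    simp only
    rw [fin4_add_one_add_one, cornerUnit_add_two, fin4_add_one_add_three]
    simp
  · rw [nextCorner_of_not_mem (by rwa [cTgt_crossPred])]
    simp only
    rw [fin4_add_three_add_one]

/-- `prevCorner` is a left inverse of `nextCorner`. [cite: Smirnov2001, §2] -/
theorem prevCorner_nextCorner (p : Site 2 × Fin 4) : prevCorner β (nextCorner β p) = p :=
  nextCorner_injective (nextCorner_prevCorner _)

/-- **The turning rule is a permutation of the coded corners.** [cite: Smirnov2001, §2] -/
def cornerPerm (β : Percolation.BondConfig (Site 2)) : Equiv.Perm (Site 2 × Fin 4) :=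
  ⟨nextCorner β, prevCorner β, prevCorner_nextCorner, nextCorner_prevCorner⟩

/-- `cornerPerm` acts as `nextCorner`. [cite: Smirnov2001, §2] -/
@[simp] theorem cornerPerm_apply (p : Site 2 × Fin 4) : cornerPerm β p = nextCorner β p := rfl

/-- The inverse of `cornerPerm` acts as `prevCorner`. [cite: Smirnov2001, §2] -/
@[simp] theorem cornerPerm_symm_apply (p : Site 2 × Fin 4) : (cornerPerm β).symm p = prevCorner β p := rfl

/-! ### The two corners arriving at an edge; toggling that edge swaps their successors -/

/-- The *cornerPartner* of the corner `(v, k)`: the other corner arriving at the same target edge,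
`(v + u_{k+1}, k + 2)` (at the other endpoint, in the opposite face). [cite: Smirnov2010, proof of Lemma 4.5] -/
def cornerPartner (p : Site 2 × Fin 4) : Site 2 × Fin 4 := (p.1 + cornerUnit (p.2 + 1), p.2 + 2)

/-- Partners arrive at the same edge. [cite: Smirnov2010, proof of Lemma 4.5] -/
theorem cTgt_partner (p : Site 2 × Fin 4) : cTgt (cornerPartner p) = cTgt p := by
  rw [cornerPartner, cTgt, cTgt]
  simp only
  rw [fin4_add_two_add_one, show p.2 + 3 = p.2 + 1 + 2 from (fin4_add_one_add_two p.2).symm, cornerUnit_add_two,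
    ← sub_eq_add_neg, add_sub_cancel_right, Sym2.eq_swap]

/-- `cornerPartner` is an involution. [cite: Smirnov2010, proof of Lemma 4.5] -/
theorem partner_partner (p : Site 2 × Fin 4) : cornerPartner (cornerPartner p) = p := by
  obtain ⟨v, k⟩ := p
  refine Prod.ext ?_ ?_
  · show v + cornerUnit (k + 1) + cornerUnit (k + 2 + 1) = v
    rw [fin4_add_two_add_one, show k + 3 = k + 1 + 2 from (fin4_add_one_add_two k).symm, cornerUnit_add_two]
    abel
  · show k + 2 + 2 = k
    exact fin4_add_two_add_two' k

/-- A corner is not its own cornerPartner. [cite: Smirnov2010, proof of Lemma 4.5] -/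
theorem partner_ne (p : Site 2 × Fin 4) : cornerPartner p ≠ p := by
  intro h
  have := congrArg Prod.snd h
  simp [cornerPartner] at this

/-- **Exactly two corners arrive at each edge**: `cTgt q = cTgt p ↔ q = p ∨ q = cornerPartner p`.
[cite: Smirnov2010, proof of Lemma 4.5] -/
theorem cTgt_eq_cTgt_iff {p q : Site 2 × Fin 4} : cTgt q = cTgt p ↔ q = p ∨ q = cornerPartner p := by
  constructor
  · intro h
    rw [cTgt, cTgt] at h
    rcases Sym2.eq_iff.1 h with ⟨h1, h2⟩ | ⟨h1, h2⟩
    · left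
      rw [h1] at h2
      have hk := cornerUnit_injective (add_left_cancel h2)
      exact Prod.ext h1 (by simpa using hk)
    · right
      rw [cornerPartner]
      refine Prod.ext h1 ?_
      rw [h1, add_assoc] at h2
      have h3 : cornerUnit (p.2 + 1) + cornerUnit (q.2 + 1) = 0 := add_left_cancel (h2.trans (add_zero p.1).symm)
      have h4 : cornerUnit (q.2 + 1) = cornerUnit (p.2 + 1 + 2) := by
        rw [cornerUnit_add_two]
        exact eq_neg_of_add_eq_zero_right h3
      rw [fin4_add_one_add_two] at h4
      exact fin4_eq_add_two_of (cornerUnit_injective h4)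
  · rintro (rfl | rfl)
    · rfl
    · exact cTgt_partner p


/-- The successor of the cornerPartner across a closed edge, and of the corner itself across the
opened edge, coincide: `(v + u_{k+1}, k + 3)`. [cite: Smirnov2010, proof of Lemma 4.5] -/
theorem nextCorner_partner_of_not_mem {p : Site 2 × Fin 4} (h : cTgt p ∉ β) :
    nextCorner β (cornerPartner p) = (p.1 + cornerUnit (p.2 + 1), p.2 + 3) := by
  rw [nextCorner_of_not_mem (by rwa [cTgt_partner]), cornerPartner]
  simp only
  rw [fin4_add_two_add_one]

/-- Following the opened edge from the cornerPartner lands where crossing it from the corner did: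
`(v, k + 1)`. [cite: Smirnov2010, proof of Lemma 4.5] -/
theorem nextCorner_partner_of_mem {p : Site 2 × Fin 4} (h : cTgt p ∈ β) :
    nextCorner β (cornerPartner p) = (p.1, p.2 + 1) := by
  rw [nextCorner_of_mem (by rwa [cTgt_partner]), cornerPartner]
  simp only
  rw [fin4_add_two_add_one, fin4_add_two_add_three,
    show p.2 + 3 = p.2 + 1 + 2 from (fin4_add_one_add_two p.2).symm, cornerUnit_add_two]
  simp

/-- **Toggling one edge composes the turning rule with a transposition.** If the configurations
`β`, `β'` agree off the edge `e = cTgt p` and differ at `e`, then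
`nextCorner β' = nextCorner β ∘ swap p (cornerPartner p)`: the two corners arriving at `e` exchange
their successors, all other corners keep theirs ("the rearrangement of connections at the
point `v`", Smirnov 2010, proof of Lemma 4.5, Fig. 5). [cite: Smirnov2010, proof of Lemma 4.5] -/
theorem nextCorner_toggle {β β' : Percolation.BondConfig (Site 2)} {p : Site 2 × Fin 4}
    (hagree : ∀ e, e ≠ cTgt p → (e ∈ β' ↔ e ∈ β)) (hdiff : ¬ (cTgt p ∈ β' ↔ cTgt p ∈ β))
    (q : Site 2 × Fin 4) :
    nextCorner β' q = nextCorner β (Equiv.swap p (cornerPartner p) q) := by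
  by_cases hq : q = p
  · subst hq
    rw [Equiv.swap_apply_left]
    by_cases h : cTgt q ∈ β
    · have h' : cTgt q ∉ β' := fun h' => hdiff ⟨fun _ => h, fun _ => h'⟩
      rw [nextCorner_of_not_mem h', nextCorner_partner_of_mem h]
    · have h' : cTgt q ∈ β' := by
        by_contra h'
        exact hdiff ⟨fun h'' => absurd h'' h', fun h'' => absurd h'' h⟩
      rw [nextCorner_of_mem h', nextCorner_partner_of_not_mem h]
  · by_cases hq' : q = cornerPartner p
    · subst hq'
      rw [Equiv.swap_apply_right]
      by_cases h : cTgt p ∈ β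
      · have h' : cTgt p ∉ β' := fun h' => hdiff ⟨fun _ => h, fun _ => h'⟩
        rw [nextCorner_of_mem h, nextCorner_partner_of_not_mem (β := β') h']
      · have h' : cTgt p ∈ β' := by
          by_contra h'
          exact hdiff ⟨fun h'' => absurd h'' h', fun h'' => absurd h'' h⟩
        rw [nextCorner_of_not_mem h, nextCorner_partner_of_mem (β := β') h']
    · rw [Equiv.swap_apply_of_ne_of_ne hq hq']
      have hne : cTgt q ≠ cTgt p := fun h => by
        rcases cTgt_eq_cTgt_iff.1 h with h | h
        · exact hq h
        · exact hq' h
      by_cases h : cTgt q ∈ β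
      · rw [nextCorner_of_mem h, nextCorner_of_mem ((hagree _ hne).2 h)]
      · rw [nextCorner_of_not_mem h, nextCorner_of_not_mem (fun h' => h ((hagree _ hne).1 h'))]


/-! ### Orbits stay over the discrete domain and are periodic -/

section Orbits

variable {D : DiscreteDobrushin} {ω : Percolation.BondConfig (Site 2)}

/-- An endpoint of an edge of `Ω_δ` is a site of `Ω_δ`. [cite: Smirnov2001, §2] -/
theorem mem_meshDomain_of_mem_edge {e : Sym2 (Site 2)} (he : e ∈ (discreteDomainGraph D.Ω D.δ).edgeSet)
    {x : Site 2} (hx : x ∈ e) : x ∈ meshDomain D.Ω D.δ := by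
  have h := Sym2.other_spec hx
  rw [← h, SimpleGraph.mem_edgeSet] at he
  exact (discreteDomainGraph_adj_iff.1 he).2.1

/-- Along any orbit of the turning rule of a completed configuration, the vertex stays in the
discrete domain once it starts there (open edges are edges of `Ω_δ`). [cite: Smirnov2001, §2] -/
theorem cornerOrbit_fst_mem_meshDomain {c : Site 2 × Fin 4} (hc : c.1 ∈ meshDomain D.Ω D.δ) (n : ℕ) :
    (cornerOrbit (D.bcBondConfig ω) c n).1 ∈ meshDomain D.Ω D.δ := by
  induction n with
  | zero => exact hc
  | succ n ih =>
    change (nextCorner (D.bcBondConfig ω) (cornerOrbit (D.bcBondConfig ω) c n)).1 ∈ _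
    by_cases h : cTgt (cornerOrbit (D.bcBondConfig ω) c n) ∈ D.bcBondConfig ω
    · rw [nextCorner_of_mem h]
      exact mem_meshDomain_of_mem_edge (D.bcBondConfig_subset ω h) (Sym2.mem_mk_right _ _)
    · rw [nextCorner_of_not_mem h]
      exact ih

/-- Cancelling equal steps along an orbit (injectivity of the turning rule). [cite: Smirnov2001, §2] -/
theorem cornerOrbit_eq_of_add_eq {β : Percolation.BondConfig (Site 2)} (c : Site 2 × Fin 4) {i j : ℕ} (d : ℕ)
    (h : cornerOrbit β c (i + d) = cornerOrbit β c (j + d)) : cornerOrbit β c i = cornerOrbit β c j := by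
  induction d with
  | zero => exact h
  | succ d ih => exact ih (nextCorner_injective h)

/-- **Orbits over the discrete domain are periodic**: the turning rule is injective and the
corners over the finite set `Ω_δ` are finitely many. [cite: Smirnov2001, §2] -/
theorem exists_cornerOrbit_period (hD : D.IsZdAdmissible) {c : Site 2 × Fin 4}
    (hc : c.1 ∈ meshDomain D.Ω D.δ) : ∃ P, 0 < P ∧ cornerOrbit (D.bcBondConfig ω) c P = c := by
  have hfin : {p : Site 2 × Fin 4 | p.1 ∈ meshDomain D.Ω D.δ}.Finite := by
    have := (meshDomain_finite hD.isBounded hD.delta_pos).prod (Set.finite_univ (α := Fin 4))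
    exact this.subset fun p hp => ⟨hp, Set.mem_univ _⟩
  obtain ⟨i, j, hij, h⟩ := hfin.exists_lt_map_eq_of_forall_mem
    (f := cornerOrbit (D.bcBondConfig ω) c) fun n => cornerOrbit_fst_mem_meshDomain hc n
  refine ⟨j - i, by omega, ?_⟩
  have := cornerOrbit_eq_of_add_eq c (i := 0) (j := j - i) i (by rwa [zero_add, Nat.sub_add_cancel hij.le])
  exact this.symm

/-- A periodic orbit repeats with its period. [cite: Smirnov2001, §2] -/
theorem cornerOrbit_add_period {β : Percolation.BondConfig (Site 2)} {c : Site 2 × Fin 4} {P : ℕ}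
    (hP : cornerOrbit β c P = c) (s : ℕ) : cornerOrbit β c (s + P) = cornerOrbit β c s := by
  induction s with
  | zero => rw [zero_add, hP]; rfl
  | succ s ih => rw [Nat.succ_add]; change nextCorner β _ = nextCorner β _; rw [ih]

/-- A periodic orbit repeats with any multiple of its period. [cite: Smirnov2001, §2] -/
theorem cornerOrbit_add_mul_period {β : Percolation.BondConfig (Site 2)} {c : Site 2 × Fin 4} {P : ℕ}
    (hP : cornerOrbit β c P = c) (s m : ℕ) : cornerOrbit β c (s + m * P) = cornerOrbit β c s := by
  induction m with
  | zero => simp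
  | succ m ih => rw [Nat.succ_mul, ← add_assoc, cornerOrbit_add_period hP, ih]

/-- On a periodic orbit, position `s` equals position `s % P`. [cite: Smirnov2001, §2] -/
theorem cornerOrbit_mod_period {β : Percolation.BondConfig (Site 2)} {c : Site 2 × Fin 4} {P : ℕ}
    (hP : cornerOrbit β c P = c) (s : ℕ) : cornerOrbit β c (s % P) = cornerOrbit β c s := by
  conv_rhs => rw [← Nat.mod_add_div s P, mul_comm]
  exact (cornerOrbit_add_mul_period hP _ _).symm

/-- A periodic orbit is closed under the predecessor: whatever steps into it was in it.
[cite: Smirnov2001, §2] -/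
theorem exists_eq_cornerOrbit_of_nextCorner {β : Percolation.BondConfig (Site 2)} {c : Site 2 × Fin 4} {P : ℕ}
    (hP0 : 0 < P) (hP : cornerOrbit β c P = c) {q : Site 2 × Fin 4} {s : ℕ}
    (h : nextCorner β q = cornerOrbit β c s) : ∃ s', q = cornerOrbit β c s' := by
  rcases s with _ | s
  · refine ⟨P - 1, nextCorner_injective (β := β) ?_⟩
    rw [h]
    change cornerOrbit β c 0 = cornerOrbit β c (P - 1 + 1)
    rw [Nat.sub_add_cancel hP0, hP]
    rfl
  · exact ⟨s, nextCorner_injective h⟩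

/-- Iterated version: if some forward iterate of `q` lies on a periodic orbit, so does `q`.
[cite: Smirnov2001, §2] -/
theorem exists_eq_cornerOrbit_of_iterate {β : Percolation.BondConfig (Site 2)} {c : Site 2 × Fin 4} {P : ℕ}
    (hP0 : 0 < P) (hP : cornerOrbit β c P = c) {q : Site 2 × Fin 4} (j : ℕ) {s : ℕ}
    (h : cornerOrbit β q j = cornerOrbit β c s) : ∃ s', q = cornerOrbit β c s' := by
  induction j generalizing q s with
  | zero => exact ⟨s, h⟩
  | succ j ih =>
    rw [cornerOrbit_succ_eq] at h
    obtain ⟨s', hs'⟩ := ih h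
    exact exists_eq_cornerOrbit_of_nextCorner hP0 hP hs'

end Orbits

/-! ### The cycle of the interface: after the exit, the next inner corner is the start corner -/

section InterfaceCycle

variable {D : DiscreteDobrushin} {ω : Percolation.BondConfig (Site 2)} {c₀ : Site 2 × Fin 4}

local notation "orb" => cornerOrbit (D.bcBondConfig ω) c₀

/-- **Entry lemma.** Along the orbit of the start corner, a step from a corner with non-inner
face to a corner with inner face can only be the step into the start corner itself: the edge
crossed is a closed face-boundary edge at a vertex of the arc `A` (left-vertex invariant) whose
other endpoint must be on `B`, i.e. an `A`–`B` edge sourced at its `A`-end — and there is only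
one such corner (`existsUnique_startCorner`). Dual to the exit analysis `cornerOrbit_exit`.
[cite: Smirnov2001, §2] -/
theorem cornerOrbit_entry (hD : D.IsZdAdmissible) (hc₀ : D.IsStartCorner c₀) {n : ℕ}
    (hout : ¬ D.IsInnerFace (cFace (orb n))) (hin : D.IsInnerFace (cFace (orb (n + 1)))) :
    orb (n + 1) = c₀ := by
  have hclosed : cTgt (orb n) ∉ D.bcBondConfig ω := fun h =>
    hout (by rwa [cornerOrbit_succ, cFace_nextCorner_of_mem h] at hin)
  have hnext : orb (n + 1) = ((orb n).1, (orb n).2 + 1) := by rw [cornerOrbit_succ, nextCorner_of_not_mem hclosed]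
  have hOut : D.IsOutEdge (orb n).1 ((orb n).2 + 1) := by
    refine ⟨?_, ?_⟩
    · have := hin; rwa [hnext] at this
    · rwa [fin4_add_one_add_three]
  obtain ⟨h1, h2⟩ := hD.arcs_cover_faceBoundary hOut.isFaceBoundaryEdge
  have hA : (orb n).1 ∈ D.zdArcA := DiscreteDobrushin.mem_zdArcA_of_inv hD (cornerOrbit_inv hc₀ n) h1
  have hB : (orb n).1 + cornerUnit ((orb n).2 + 1) ∈ D.zdArcB := by
    rcases h2 with h2 | h2
    · refine absurd (DiscreteDobrushin.mem_bcBondConfig_of_arcA hOut.isFaceBoundaryEdge.1 ?_) hclosed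
      intro x hx
      rcases Sym2.mem_iff.1 hx with rfl | rfl
      · exact hA
      · exact h2
    · exact h2
  rw [hnext]
  exact (DiscreteDobrushin.existsUnique_startCorner hD).unique ⟨hA, hB, hOut⟩
    ⟨hc₀.mem_zdArcA, hc₀.mem_zdArcB, hc₀.isOutEdge⟩

/-- **The cycle structure of the interface orbit.** With `N` the exit time (first corner with
non-inner face) and `P` the period (first return to the start corner): `N < P`... precisely, every
corner at a time `s` with `N ≤ s < P` has a non-inner face. [cite: Smirnov2001, §2] -/
theorem not_isInnerFace_of_exit_le (hD : D.IsZdAdmissible) (hc₀ : D.IsStartCorner c₀) {N P : ℕ}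
    (hN : ¬ D.IsInnerFace (cFace (orb N))) (hPmin : ∀ s, 0 < s → s < P → orb s ≠ c₀) {s : ℕ} (hNs : N ≤ s)
    (hsP : s < P) : ¬ D.IsInnerFace (cFace (orb s)) := by
  induction s, hNs using Nat.le_induction with
  | base => exact hN
  | succ s hNs ih =>
    intro hin
    have hout := ih (by omega)
    exact hPmin (s + 1) (Nat.succ_pos _) hsP (cornerOrbit_entry hD hc₀ hout hin)

/-- The period of the interface orbit exceeds its exit time. [cite: Smirnov2001, §2] -/
theorem exit_lt_period (hD : D.IsZdAdmissible) (hc₀ : D.IsStartCorner c₀) {N P : ℕ}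
    (hlt : ∀ k < N, D.IsInnerFace (cFace (orb k))) (hP0 : 0 < P) (hP : orb P = c₀) : N < P := by
  by_contra h
  have hPN : P ≤ N := not_lt.1 h
  exact cornerOrbit_ne hD hc₀ hP0 (fun k hk => hlt k (lt_of_lt_of_le hk hPN)) (by rw [cornerOrbit_zero, hP])

/-- **Inner corners of the interface cycle are interface darts**: on the orbit of the start corner
(exit time `N`, minimal period `P`), the face of `orb s` is inner iff `s % P < N`. [cite: Smirnov2001, §2] -/
theorem isInnerFace_cornerOrbit_iff (hD : D.IsZdAdmissible) (hc₀ : D.IsStartCorner c₀) {N P : ℕ}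
    (hN : ¬ D.IsInnerFace (cFace (orb N))) (hlt : ∀ k < N, D.IsInnerFace (cFace (orb k)))
    (hP0 : 0 < P) (hP : orb P = c₀) (hPmin : ∀ s, 0 < s → s < P → orb s ≠ c₀) (s : ℕ) :
    D.IsInnerFace (cFace (orb s)) ↔ s % P < N := by
  rw [← cornerOrbit_mod_period hP s]
  have hsP : s % P < P := Nat.mod_lt _ hP0
  constructor
  · intro h
    by_contra hns
    exact not_isInnerFace_of_exit_le hD hc₀ hN hPmin (not_lt.1 hns) hsP h
  · intro h
    exact hlt _ h

end InterfaceCycle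

end Literature.Probability.LatticeModels
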